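import Summits.RiemannHypothesis.RiemannHypothesis.Theorems.WeilFormatCPolyWindowEntryBox
import Summits.RiemannHypothesis.RiemannHypothesis.Theorems.WeilFormatCPolyWindowMixedEntry
import Summits.RiemannHypothesis.RiemannHypothesis.Theorems.WeilFormatCEntryArchSeries
import Summits.RiemannHypothesis.RiemannHypothesis.Theorems.WeilFormatCWindowCoeffDecay
import Literature.Analysis.SpecialFunctions.DigammaReflection
import HarnessLib

/-!
# Format C, design C∞ — (E) side III-a: kernel pieces of the mixed entries `W_a(1x^j, χ_m)` (block × profile)

Route context: Fourier–Galerkin / Schur-complement certificates of Weil positivity on a window ("format C", design C∞;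
`run/shared/lean/pub/rh-explicit/rh-explicit-weil-10/KERNEL-LEVER.md` §17 item (ii); supporting stmt-RiemannHypothesis-0098;
seats rh-explicit-weil-2 / weil-10).  The mixed entry `WeilFormatCPolyWindowMixedEntry.weilWindowSesq_indicator_pow_chi`
(`m ≠ 0`, `ω = πm/a`) is built from: the pole moments `C_j, S_j` (boxes in `…PoleBox`), the factors `((−iω)^{k+1})⁻¹`,
the prime phases `e^{±iω log n}` (the light-table list `IdxRec.cs`), the window integrals `∫_{(0,2a]} ρ (1 − e^{±iωt}) = J_c ∓ iJ_s`
with `J_s = ½ Im ψ(¼+iω/2) − Σ_k e^{−2a l_k} ω/(l_k²+ω²)` (`WeilFormatCEntryArchSeries.setIntegral_weilArchDensity_mul_sin`: the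
light-table fields `imP`, `eS`) and `J_c = ½(Re ψ(¼+iω/2) − ψ(¼)) − Σ_k e^{−2a l_k} f_{l_k}(ω)/2`
(`WeilFormatCPolyWindowMixedArch.setIntegral_weilArchDensity_mul_one_sub_cos`: field `reP`, a box of `ψ(¼) = −γ − π/2 − 3 log 2`,
and a NEW truncated node sum widened by the certified tail `2·tailE`), the polynomial window integrals `∫ρ P_q` through the
W-table (`setIntegral_weilArchDensity_mul_mixedPolyKernel`), and the Fourier coefficient `ĉ_m(x^j)` (`fourierCoeff_ofReal_pow_eq_sum`).
This file provides these PIECES as boxes with inclusion lemmas (`mem_ipowBox`, `mem_jsBox`, `mem_psiQuarterBox`, `mem_jcBox`,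
`mem_polyIntBox`, `mem_fourierBox`) and the complex list-sum bridge `sum_weilPrimeIndex_mul_eq_listSum_complex`; the assembly
of the entry is the sibling `…MixedBox.lean`.  Interval plumbing; standard axioms; no RH claim.
-/

set_option autoImplicit false
-- `Summit.RiemannHypothesis.RiemannHypothesis.…` is the layout-mandated namespace (summit = problem name).
set_option linter.dupNamespace false

open Complex Filter Set MeasureTheory Finset
open scoped Real Topology ArithmeticFunction.vonMangoldt ComplexConjugate

namespace Summit.RiemannHypothesis.RiemannHypothesis.Theorems.WeilFormatC

open Literature.NumberTheory.LFunctions Literature.Analysis.SpecialFunctions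
open Literature.Analysis.ValidatedNumerics Literature.Analysis.ValidatedNumerics.NumericsMP
open Literature.NumberTheory.LFunctions.Yoshida1992 (PrimeLen PrimeData freq archExpSumSin)
open Literature.NumberTheory.LFunctions.Yoshida1992.Encl (Consts ConstsValid IdxRec OffValid DiagValid EksValid
  list_sum_map_eq_sum_range)

namespace WinMixed

open WinConst (ratBox mem_ratBox mulRatBox mem_mulRatBox)
open WinPrime (powBox mem_powBox)
open WinEntry (sumBox mem_sumBox wtab)

/-! ## The complex list-sum bridge -/

/-- For any complex weight `F` of the length:
`Σ_{n ∈ weilPrimeIndex a} (Λ(n) n^{−1/2} : ℂ) F(log n) = Σ_{q ∈ ks} (Λ(q)q^{−1/2} : ℂ) F(ℓ_q)`. -/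
theorem sum_weilPrimeIndex_mul_eq_listSum_complex {a : ℝ} {ks : List PrimeLen} (h : PrimeData a ks) (F : ℝ → ℂ) :
    ∑ n ∈ weilPrimeIndex a, (((Λ n : ℝ) / Real.sqrt n : ℝ) : ℂ) * F (Real.log n) =
      (ks.map fun q ↦ ((q.wt : ℝ) : ℂ) * F q.len).sum := by
  have step1 : ∑ n ∈ weilPrimeIndex a, (((Λ n : ℝ) / Real.sqrt n : ℝ) : ℂ) * F (Real.log n)
      = ∑ n ∈ (weilPrimeIndex a).filter IsPrimePow, (((Λ n : ℝ) / Real.sqrt n : ℝ) : ℂ) * F (Real.log n) := by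
    refine (Finset.sum_filter_of_ne fun n _ hne ↦ ?_).symm
    by_contra hn
    rw [ArithmeticFunction.vonMangoldt_eq_zero_iff.mpr hn] at hne
    simp at hne
  have step2 : (weilPrimeIndex a).filter IsPrimePow = (ks.map PrimeLen.val).toFinset := by
    ext n
    simp only [Finset.mem_filter, List.mem_toFinset]
    constructor
    · rintro ⟨hn, hpp⟩; exact (h.mem_iff n hpp).1 hn
    · intro hn
      have hpp : IsPrimePow n := by
        obtain ⟨q, hq, rfl⟩ := List.mem_map.1 hn
        exact PrimeLen.isPrimePow_val (h.prime q hq)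
      exact ⟨(h.mem_iff n hpp).2 hn, hpp⟩
  rw [step1, step2, List.sum_toFinset _ h.nodup, List.map_map]
  congr 1
  refine List.map_congr_left fun q hq ↦ ?_
  simp only [Function.comp_apply]
  rw [PrimeLen.vonMangoldt_div_sqrt_val (h.prime q hq), PrimeLen.log_val]

/-- A complex list sum as a `range` sum over `getD`. -/
theorem list_sum_map_eq_sum_range_complex {α : Type} [Inhabited α] (g : α → ℂ) :
    ∀ l : List α, (l.map g).sum = ∑ i ∈ Finset.range l.length, g (l.getD i default)
  | [] => by simp
  | x :: xs => by
      rw [List.map_cons, List.sum_cons, List.length_cons, Finset.sum_range_succ', list_sum_map_eq_sum_range_complex g xs]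
      simp [add_comm]

/-! ## Complex sums of boxes -/

/-- `Σ_{i<n} f i` of complex boxes. -/
def sumBoxC (S : ℕ) (f : ℕ → MC) : ℕ → MC
  | 0 => MC.ofInt S 0
  | n + 1 => (sumBoxC S f n).add (f n)

/-- `sumBoxC ∋ Σ_{i<n} g i`. -/
theorem mem_sumBoxC {S : ℕ} {f : ℕ → MC} {g : ℕ → ℂ} :
    ∀ n : ℕ, (∀ i < n, MC.mem S (g i) (f i)) → MC.mem S (∑ i ∈ Finset.range n, g i) (sumBoxC S f n)
  | 0, _ => by simpa [sumBoxC] using MC.mem_ofInt S 0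
  | n + 1, h => by
    rw [Finset.sum_range_succ, sumBoxC]
    exact MC.mem_add (mem_sumBoxC n fun i hi ↦ h i (by omega)) (h n (by omega))

/-! ## The factors `((−iω)^{n})⁻¹ = (ω⁻¹ i)^{n}` -/

/-- `(u·i)^n` for an enclosed real `u`. -/
def ipowBox (S : ℕ) (U : MI) : ℕ → MC
  | 0 => MC.ofInt S 1
  | n + 1 => ((ipowBox S U n).mulMI S U).mulI

/-- `ipowBox ∋ ((u : ℂ) I)^n`. -/
theorem mem_ipowBox {S : ℕ} (hS : 0 < S) {u : ℝ} {U : MI} (hu : MI.mem S u U) :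
    ∀ n : ℕ, MC.mem S (((u : ℂ) * I) ^ n) (ipowBox S U n)
  | 0 => by simpa [ipowBox] using MC.mem_ofInt S 1
  | n + 1 => by
    rw [pow_succ, ipowBox, show ((u : ℂ) * I) ^ n * ((u : ℂ) * I) = ((u : ℂ) * I) ^ n * (u : ℂ) * I by ring]
    exact MC.mem_mulI (MC.mem_mulMI hS (mem_ipowBox hS hu n) hu)

/-- `((−(iω))^n)⁻¹ = (ω⁻¹ i)^n` (`ω ≠ 0` not needed: both sides are `0`-free identities of `ℂ`). -/
theorem inv_neg_I_mul_pow (ω : ℝ) (n : ℕ) : ((-(I * (ω : ℂ))) ^ n)⁻¹ = (((ω⁻¹ : ℝ) : ℂ) * I) ^ n := by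
  rw [← inv_pow]
  congr 1
  rw [inv_neg, mul_inv, Complex.inv_I]
  push_cast
  ring

/-- `1/ω` as a box (`ω` with a positive enclosure). -/
def invBox (S : ℕ) (Om : MI) : Option MI := MI.divPos S (MI.ofInt S 1) Om

/-- `invBox ∋ ω⁻¹`. -/
theorem mem_invBox {S : ℕ} (hS : 0 < S) {ω : ℝ} {Om U : MI} (hω : MI.mem S ω Om) (h : invBox S Om = some U) :
    MI.mem S ω⁻¹ U := by
  have := MI.mem_divPos hS h (MI.mem_ofInt S 1) hω
  simpa [one_div] using this

/-! ## `J_s` and `J_c` -/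

section J

variable {S : ℕ} {a : ℚ} {ks : List PrimeLen} {m : ℤ} {R : IdxRec}

/-- Box of `J_s = ∫_{(0,2a]} ρ sin(ω_m t) = ½ Im ψ(¼+iω_m/2) − Σ_k e^{−2a l_k} ω_m/(l_k²+ω_m²)`. -/
def jsBox (R : IdxRec) : MI := (R.imP.divNat 2).sub R.eS

/-- `jsBox ∋ J_s` (`a > 0`). -/
theorem mem_jsBox (ha : 0 < a) (hR : OffValid S (a : ℝ) ks m R) :
    MI.mem S (∫ t in Ioc 0 (2 * (a : ℝ)), weilArchDensity t * Real.sin (π * m / (a : ℝ) * t)) (jsBox R) := by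
  have ha' : (0 : ℝ) < a := by exact_mod_cast ha
  rw [setIntegral_weilArchDensity_mul_sin ha' m, jsBox]
  have h1 := hR.imP
  have h2 := hR.eS
  simp only [freq, archExpSumSin] at h1 h2
  exact MI.mem_sub (MI.mem_divNat h1 (n := 2) (by norm_num)) h2

/-- Box of `ψ(¼) = Re ψ(¼) = −γ − π/2 − 3 log 2` from boxes of `π`, `log 2`, `γ`. -/
def psiQuarterBox (P L2 G : MI) : MI := ((G.neg).sub (P.divNat 2)).sub (L2.mulInt 3)

/-- `psiQuarterBox ∋ reDigammaQuarter 0 = ψ(¼)`. -/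
theorem mem_psiQuarterBox {P L2 G : MI} (hP : MI.mem S Real.pi P) (hL2 : MI.mem S (Real.log 2) L2)
    (hG : MI.mem S Real.eulerMascheroniConstant G) : MI.mem S (reDigammaQuarter 0) (psiQuarterBox P L2 G) := by
  have hval : reDigammaQuarter 0 = -Real.eulerMascheroniConstant - Real.pi / 2 - Real.log 2 * (3 : ℤ) := by
    rw [reDigammaQuarter]
    have e : (1 / 4 + ((0 : ℝ) : ℂ) / 2 * I) = 1 / 4 := by simp
    rw [e, Literature.Analysis.SpecialFunctions.Complex.digamma_one_quarter]
    have h2 : (Complex.log 2).re = Real.log 2 := by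
      rw [show (2 : ℂ) = ((2 : ℝ) : ℂ) by norm_num, Complex.log_ofReal_re]
    simp only [Complex.sub_re, Complex.neg_re, Complex.ofReal_re, Complex.div_re, Complex.mul_re, h2]
    simp
    ring
  rw [hval, psiQuarterBox]
  exact MI.mem_sub (MI.mem_sub (MI.mem_neg hG) (MI.mem_divNat hP (n := 2) (by norm_num))) (MI.mem_mulInt hL2 3)

/-- `f_{l_k}(ω)/2 = ω²/(l_k(l_k²+ω²))` as a box (`none` if the denominator box is not positive). -/
def halfTermBox (S : ℕ) (Om : MI) (k : ℕ) : Option MI :=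
  let L := ratBox S ((4 * (k : ℚ) + 1) / 2)
  MI.divPos S (Om.sqr S) (L.mul S ((L.sqr S).add (Om.sqr S)))

/-- `halfTermBox ∋ digammaTerm l_k ω / 2`. -/
theorem mem_halfTermBox (hS : 0 < S) {ω : ℝ} {Om H : MI} (hω : MI.mem S ω Om) {k : ℕ}
    (h : halfTermBox S Om k = some H) : MI.mem S (digammaTerm (digammaNode k) ω / 2) H := by
  have hL : MI.mem S (digammaNode k) (ratBox S ((4 * (k : ℚ) + 1) / 2)) := by
    have := mem_ratBox S ((4 * (k : ℚ) + 1) / 2)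
    convert this using 1
    rw [digammaNode]; push_cast; ring
  have hden := MI.mem_mul hS hL (MI.mem_add (MI.mem_sqr hS hL) (MI.mem_sqr hS hω))
  have hq := MI.mem_divPos hS h (MI.mem_sqr hS hω) hden
  convert hq using 1
  rw [digammaTerm]
  have hl := digammaNode_pos k
  have : digammaNode k * (digammaNode k ^ 2 + ω ^ 2) ≠ 0 := by positivity
  field_simp

/-- The truncated node sum `Σ_{k<K} e_k f_{l_k}(ω)/2` (`none` if a term box fails). -/
def cTruncBox (S : ℕ) (eks : List MI) (Om : MI) : ℕ → Option MI
  | 0 => some (MI.ofInt S 0)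
  | K + 1 =>
    match cTruncBox S eks Om K, halfTermBox S Om K with
    | some acc, some H => some (acc.add ((eks.getD K default).mul S H))
    | _, _ => none

/-- `cTruncBox … K ∋ Σ_{k<K} e^{−2a l_k} f_{l_k}(ω)/2` along a valid exponential table. -/
theorem mem_cTruncBox (hS : 0 < S) {eks : List MI} (heks : EksValid S (a : ℝ) eks) {ω : ℝ} {Om : MI}
    (hω : MI.mem S ω Om) : ∀ (K : ℕ) {B : MI}, K ≤ eks.length → cTruncBox S eks Om K = some B →
      MI.mem S (∑ k ∈ Finset.range K, Real.exp (-(2 * (a : ℝ) * digammaNode k)) * (digammaTerm (digammaNode k) ω / 2)) B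
  | 0, B, _, h => by
    simp only [cTruncBox, Option.some.injEq] at h
    subst h; simpa using MI.mem_ofInt S 0
  | K + 1, B, hK, h => by
    simp only [cTruncBox] at h
    split at h
    · rename_i acc H hacc hH
      simp only [Option.some.injEq] at h
      subst h
      rw [Finset.sum_range_succ]
      exact MI.mem_add (mem_cTruncBox hS heks hω K (by omega) hacc)
        (MI.mem_mul hS (heks K (by omega)) (mem_halfTermBox hS hω hH))
    · simp at h

/-- Box of `J_c = ½(Re ψ(¼+iω/2) − ψ(¼)) − Σ_k e^{−2a l_k} f_{l_k}(ω)/2`: truncated node sum widened by `2·tailE`. -/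
def jcBox (S : ℕ) (C : Consts) (R : IdxRec) (Psi4 : MI) : Option MI :=
  match cTruncBox S C.eks R.om C.eks.length with
  | some B => some (((R.reP.sub Psi4).divNat 2).sub (B.widen (2 * C.tailE)))
  | none => none

/-- **`jcBox ∋ J_c(m) = ∫_{(0,2a]} ρ (1 − cos ω_m t)`** (`a > 0`). -/
theorem mem_jcBox (hS : 0 < S) (ha : 0 < a) {C : Consts} (hC : ConstsValid S (a : ℝ) ks C)
    (hR : OffValid S (a : ℝ) ks m R) (hD : DiagValid S (a : ℝ) m R) {Psi4 : MI}
    (hPsi : MI.mem S (reDigammaQuarter 0) Psi4) {Jc : MI} (h : jcBox S C R Psi4 = some Jc) :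
    MI.mem S (∫ t in Ioc 0 (2 * (a : ℝ)), weilArchDensity t * (1 - Real.cos (π * m / (a : ℝ) * t))) Jc := by
  have ha' : (0 : ℝ) < a := by exact_mod_cast ha
  rw [setIntegral_weilArchDensity_mul_one_sub_cos ha' m]
  unfold jcBox at h
  split at h
  · rename_i B hB
    simp only [Option.some.injEq] at h
    subst h
    have hreP := hD.reP
    simp only [freq] at hreP
    have hω := hR.om
    simp only [freq] at hω
    refine MI.mem_sub (MI.mem_divNat (MI.mem_sub hreP hPsi) (n := 2) (by norm_num)) ?_
    -- the node sum: truncation + tail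
    set K := C.eks.length
    set f : ℕ → ℝ := fun k ↦ Real.exp (-(2 * (a : ℝ) * digammaNode k)) *
      (digammaTerm (digammaNode k) (π * m / (a : ℝ)) / 2)
    have hsum : Summable f := summable_exp_mul_digammaTerm ha' _
    have htr := mem_cTruncBox hS hC.eks hω K le_rfl hB
    refine MI.mem_widen htr ?_
    -- `|Σ' f − Σ_{k<K} f| ≤ 2 e^{−a(4K+1)}/(1−e^{−4a}) ≤ 2 tailE / S`
    rw [← hsum.sum_add_tsum_nat_add K, add_sub_cancel_left]
    have hsK := hsum.comp_injective (add_left_injective K)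
    have h1 : |∑' k, f (k + K)| ≤ ∑' k, |f (k + K)| := by
      have := norm_tsum_le_tsum_norm hsK.norm
      simpa only [Real.norm_eq_abs, Function.comp] using this
    have hs' : Summable fun k ↦ 2 * (Real.exp (-(a : ℝ)) * Real.exp (-(4 * (a : ℝ))) ^ (k + K)) :=
      ((Yoshida1992.summable_exp_geom ha').comp_injective (add_left_injective K)).mul_left 2
    have h2 : ∑' k, |f (k + K)| ≤ ∑' k, 2 * (Real.exp (-(a : ℝ)) * Real.exp (-(4 * (a : ℝ))) ^ (k + K)) := by
      refine Summable.tsum_le_tsum (fun k ↦ ?_) hsK.abs hs'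
      simp only [f]
      rw [abs_mul, abs_of_pos (Real.exp_pos _), Yoshida1992.exp_node_eq]
      have hb : |digammaTerm (digammaNode (k + K)) (π * m / (a : ℝ)) / 2| ≤ 2 := by
        rw [abs_div, abs_two]
        linarith [abs_digammaTerm_digammaNode_le (π * m / (a : ℝ)) (k + K)]
      have h0 : 0 ≤ Real.exp (-(a : ℝ)) * Real.exp (-(4 * (a : ℝ))) ^ (k + K) := by positivity
      nlinarith
    have h3 : ∑' k, 2 * (Real.exp (-(a : ℝ)) * Real.exp (-(4 * (a : ℝ))) ^ (k + K)) =
        2 * (Real.exp (-((a : ℝ) * (4 * K + 1))) / (1 - Real.exp (-(4 * (a : ℝ))))) := by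
      rw [tsum_mul_left, Yoshida1992.tsum_exp_geom_shift ha' K, Yoshida1992.exp_geom_pow_eq]
    have htail := hC.tail
    have hSr : (0 : ℝ) ≤ S := Nat.cast_nonneg S
    calc |∑' k, f (k + K)| * S ≤ (2 * (Real.exp (-((a : ℝ) * (4 * K + 1))) / (1 - Real.exp (-(4 * (a : ℝ)))))) * S := by
          refine mul_le_mul_of_nonneg_right ?_ hSr
          exact h1.trans (h2.trans h3.le)
      _ = 2 * (Real.exp (-((a : ℝ) * (4 * C.eks.length + 1))) / (1 - Real.exp (-(4 * (a : ℝ)))) * S) := by ring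
      _ ≤ 2 * (C.tailE : ℝ) := by nlinarith [htail]
      _ = ((2 * C.tailE : ℤ) : ℝ) := by push_cast; ring
  · simp at h

end J

/-! ## The polynomial window integrals `∫ρ P_q` through the W-table -/

section Poly

variable {S : ℕ} {a : ℚ} {tab : List MI} {Q : ℕ}

/-- Box of `∫_{(0,2a]} ρ P_q = Σ_{l<q} C(q,l+1)((−a)^{q−(l+1)} + (−1)^l a^{q−(l+1)}) W_{l+1}`. -/
def polyIntBox (S : ℕ) (tab : List MI) (a : ℚ) (q : ℕ) : MI :=
  sumBox S (fun l ↦ mulRatBox (wtab tab (l + 1))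
    (((q.choose (l + 1) : ℕ) : ℚ) * ((-a) ^ (q - (l + 1)) + (-1) ^ l * a ^ (q - (l + 1))))) q

/-- **`polyIntBox ∋ ∫_{(0,2a]} ρ P_q`** given a valid W-table up to `Q ≥ q`. -/
theorem mem_polyIntBox (ha : 0 < a) (hW : ∀ p, 1 ≤ p → p ≤ Q →
      MI.mem S (∫ t in Ioc 0 (2 * (a : ℝ)), weilArchDensity t * t ^ p) (wtab tab p)) {q : ℕ} (hq : q ≤ Q) :
    MI.mem S (∫ t in Ioc 0 (2 * (a : ℝ)), weilArchDensity t *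
        (((a : ℝ) ^ q - ((a : ℝ) - t) ^ q) + ((-(a : ℝ) + t) ^ q - (-(a : ℝ)) ^ q))) (polyIntBox S tab a q) := by
  have ha' : (0 : ℝ) < a := by exact_mod_cast ha
  rw [setIntegral_weilArchDensity_mul_mixedPolyKernel ha' q, polyIntBox]
  refine mem_sumBox q fun l hl ↦ ?_
  have h := mem_mulRatBox (hW (l + 1) (by omega) (by omega))
    (((q.choose (l + 1) : ℕ) : ℚ) * ((-a) ^ (q - (l + 1)) + (-1) ^ l * a ^ (q - (l + 1))))
  convert h using 1
  push_cast
  ring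

end Poly

/-! ## The Fourier coefficient `ĉ_m(x^j)` -/

section Fourier

variable {S : ℕ} {a : ℚ}

/-- Box of `ĉ_m(x^j) = (−1)^m Σ_k (−1)^k j^{(k)} (a^{j−k} − (−a)^{j−k})·((−iω)^{k+1})⁻¹` with `U ∋ ω⁻¹`, `sg = (−1)^m`. -/
def fourierBox (S : ℕ) (U : MI) (sg : ℤ) (a : ℚ) (j : ℕ) : MC :=
  (sumBoxC S (fun k ↦ (ipowBox S U (k + 1)).mulMI S
      (ratBox S ((-1) ^ k * (j.descFactorial k : ℚ) * (a ^ (j - k) - (-a) ^ (j - k))))) (j + 1)).mulInt sg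

/-- **`fourierBox ∋ fourierCoeff a m (x^j)`** (`a > 0`, `m ≠ 0`; `U ∋ (πm/a)⁻¹`, `sg = (−1)^m`). -/
theorem mem_fourierBox (hS : 0 < S) (ha : 0 < a) {m : ℤ} (hm : m ≠ 0) {U : MI}
    (hU : MI.mem S (π * m / (a : ℝ))⁻¹ U) {sg : ℤ} (hsg : (-1 : ℂ) ^ m = (sg : ℂ)) (j : ℕ) :
    MC.mem S (Yoshida1992.fourierCoeff (a : ℝ) m (fun x : ℝ ↦ ((x : ℂ)) ^ j)) (fourierBox S U sg a j) := by
  have ha' : (a : ℝ) ≠ 0 := by exact_mod_cast ha.ne'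
  rw [fourierCoeff_ofReal_pow_eq_sum ha' hm j, fourierBox, hsg, mul_comm]
  refine MC.mem_mulInt (mem_sumBoxC (j + 1) fun k hk ↦ ?_) sg
  have hden : (I * (((π * (((-m : ℤ)) : ℝ) / (a : ℝ) : ℝ)) : ℂ)) ^ (k + 1) = (-(I * ((π * m / (a : ℝ) : ℝ) : ℂ))) ^ (k + 1) := by
    congr 1; push_cast; ring
  rw [hden, div_eq_mul_inv, inv_neg_I_mul_pow]
  have h := MC.mem_mulMI hS (mem_ipowBox hS hU (k + 1))
    (mem_ratBox S ((-1) ^ k * (j.descFactorial k : ℚ) * (a ^ (j - k) - (-a) ^ (j - k))))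
  convert h using 1
  push_cast
  ring

end Fourier

end WinMixed

end Summit.RiemannHypothesis.RiemannHypothesis.Theorems.WeilFormatC
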